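import Summits.Ventures.YMGap.FlowData.TubeFluxNonAnnihilationAll
import Summits.Ventures.YMGap.FlowData.TubeVacuumSector
import Summits.Ventures.YMGap.FlowData.TubeTransferPositivity
import Literature.Analysis.OperatorTheory.CompactPositiveTopLevel
import HarnessLib

/-!
# Venture YMGap, track Y3 FLOW-DATA — the SECTOR TOP `λ̂₀^{(e)} = ‖T ∘ P_e‖` IS AN ATTAINED EIGENVALUE of the tube
# transfer operator, with an eigenvector IN the flux sector `e`, and it is the largest one there (theorems only)

HONEST FRAMING: venture file of the cell `pub-ymgap` (QuantumFields programme), track Y3; a DICTIONARY theorem for the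
typed objects of `FlowData/TorelonEnergy.lean`.  FLOW-PLAN O1 defines `λ̂₀^{(e)} := max spec T̂ restricted to flux e`
and `E_e := ln(λ̂₀/λ̂₀^{(e)})`; the tree types `E_e` through the OPERATOR NORM `tubeSectorNorm = ‖T ∘ P_e‖`
(`fluxEnergy = log ‖T‖ − log ‖T ∘ P_e‖`).  This file proves the two readings coincide: for a continuous unitary
representation `ρ`, a central involution `z` and `J ≥ 0`, whenever `‖T ∘ P_e‖ > 0` there is a UNIT VECTOR `φ` with
`P_e φ = φ` (it lies in the flux sector `e`) and `T φ = ‖T ∘ P_e‖ · φ`; and every eigenvalue of `T` with an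
eigenvector in the sector `e` lies in `[0, ‖T ∘ P_e‖]`.  Mechanism: `T ∘ P_e` is compact (`T` is), self-adjoint
(`P_e` is a self-adjoint idempotent commuting with `T`) and positive (Lüscher positivity `T ⪰ 0` for `J ≥ 0`,
`TubeTransferPositivity`), so its norm is an attained eigenvalue (Hilbert–Schmidt theorem, tree
`CompactPositiveTopLevel.exists_eigenvector_norm_of_re_inner_nonneg`); the eigenvector is automatically in the range of
`P_e`.  Finite spatial torus `(ℤ/L)^k`, one transfer step; nothing about `L → ∞`, the continuum or a mass gap; no
number, no row.

* `isCompactOperator_comp_tubeFluxProjection`, `isSelfAdjoint_comp_tubeFluxProjection`,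
  `inner_comp_tubeFluxProjection_self_nonneg` — `T ∘ P_e` is compact, self-adjoint, positive;
* ★ `exists_eigenvector_tubeSectorNorm` — `0 < ‖T ∘ P_e‖ → ∃ φ, ‖φ‖ = 1 ∧ P_e φ = φ ∧ T φ = ‖T ∘ P_e‖ • φ`;
* `eigenvalue_mem_Icc_of_mem_sector` — `P_e ψ = ψ → ψ ≠ 0 → T ψ = μ • ψ → μ ∈ [0, ‖T ∘ P_e‖]`;
* ★ `su2_exists_eigenvector_tubeSectorNorm` — the cell's case: `SU(2)`, fundamental, `z = −1`, `J = β/2`, EVERY `β > 0`,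
  EVERY slice dimension `k`, side `L` and flux `e` (sector tops are `> 0` by `TubeFluxNonAnnihilationAll` /
  `TubeVacuumSector`): `λ̂₀^{(e)}` is an eigenvalue of `T̂` attained on the sector `e`, so that
  `E_e = su2FluxEnergy β k L e = log λ̂₀ − log λ̂₀^{(e)}` with BOTH `λ̂`'s genuine eigenvalues (`su2FluxEnergy_eq_log_div`).

References: M. Lüscher, Commun. Math. Phys. 54 (1977) 283 [cite: Luscher1977]; G. 't Hooft, Nucl. Phys. B 153 (1979)
141 [cite: tHooft1979Flux]; M. Reed, B. Simon I (1980) Thm VI.16 [cite: ReedSimonI1980, Thm. VI.16]; IV (1978) XIII.12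
[cite: ReedSimonIV1978, Thm XIII.44].
-/

noncomputable section

open scoped InnerProductSpace
open MeasureTheory
open Literature.MathematicalPhysics.QuantumFieldTheory Literature.Analysis.OperatorTheory
open Literature.MathematicalPhysics.QuantumLattice (fundamentalRep continuous_fundamentalRep fundamentalRep_mem_unitaryGroup)

namespace Summit.Ventures.YMGap.FlowData

section General

variable {G : Type*} [Group G] [TopologicalSpace G] [IsTopologicalGroup G] [CompactSpace G]
  [MeasurableSpace G] [BorelSpace G] [SecondCountableTopology G]
  {n : ℕ} (ρ : G →* Matrix (Fin n) (Fin n) ℂ) (J : ℝ) {k L : ℕ} [NeZero L]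

/-- `T ∘ P_e` is a compact operator (`T` is). [folklore] -/
theorem isCompactOperator_comp_tubeFluxProjection (hρ : Continuous ρ) (z : G) (e : Fin k → ZMod 2) :
    IsCompactOperator ((tubeTransferOperator ρ J k L).comp (tubeFluxProjection z k L e)) :=
  (isCompactOperator_tubeTransferOperator J k L hρ).comp_clm (tubeFluxProjection z k L e)

/-- `T ∘ P_e` is self-adjoint (central involution `z`, unitary `ρ`: `P_e` is self-adjoint and commutes with `T`).
[cite: tHooft1979Flux] -/
theorem isSelfAdjoint_comp_tubeFluxProjection (hρ : Continuous ρ) (hρu : ∀ g, ρ g ∈ Matrix.unitaryGroup (Fin n) ℂ)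
    {z : G} (hz : z ∈ Subgroup.center G) (hz2 : z * z = 1) (e : Fin k → ZMod 2) :
    IsSelfAdjoint ((tubeTransferOperator ρ J k L).comp (tubeFluxProjection z k L e)) := by
  have hT := isSelfAdjoint_tubeTransferOperator J k L hρ hρu
  have hP := isSelfAdjoint_tubeFluxProjection z hz2 (k := k) (L := L) e
  have hcomm : Commute (tubeTransferOperator ρ J k L) (tubeFluxProjection z k L e) := by
    change tubeTransferOperator ρ J k L * tubeFluxProjection z k L e =
      tubeFluxProjection z k L e * tubeTransferOperator ρ J k L
    rw [ContinuousLinearMap.mul_def, ContinuousLinearMap.mul_def]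
    exact (tubeFluxProjection_comp_tubeTransferOperator ρ J hρ hz e).symm
  exact (IsSelfAdjoint.commute_iff hT hP).1 hcomm

/-- `T ∘ P_e ⪰ 0` in quadratic form for `J ≥ 0`: `⟪x, T P_e x⟫ = ⟪P_e x, T P_e x⟫ ≥ 0` (Lüscher positivity).
[cite: Luscher1977] -/
theorem inner_comp_tubeFluxProjection_self_nonneg (hρ : Continuous ρ)
    (hρu : ∀ g, ρ g ∈ Matrix.unitaryGroup (Fin n) ℂ) {z : G} (hz : z ∈ Subgroup.center G) (hz2 : z * z = 1)
    (hJ : 0 ≤ J) (e : Fin k → ZMod 2) (x : Lp ℝ 2 (sliceMeasure G k L)) :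
    0 ≤ @inner ℝ _ _ x (((tubeTransferOperator ρ J k L).comp (tubeFluxProjection z k L e)) x) := by
  set T := tubeTransferOperator ρ J k L
  set P := tubeFluxProjection z k L e
  have hPP : P.comp P = P := tubeFluxProjection_comp_self z hz2 e
  have hPT : P.comp T = T.comp P := tubeFluxProjection_comp_tubeTransferOperator ρ J hρ hz e
  have hPsa : IsSelfAdjoint P := isSelfAdjoint_tubeFluxProjection z hz2 (k := k) (L := L) e
  -- `⟪x, T P x⟫ = ⟪x, P T P x⟫ = ⟪P x, T P x⟫`
  have h1 : (T.comp P) x = P (T (P x)) := by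
    have := congrArg (fun S : Lp ℝ 2 (sliceMeasure G k L) →L[ℝ] Lp ℝ 2 (sliceMeasure G k L) => S x)
      (show T.comp P = (P.comp T).comp P by rw [hPT, ContinuousLinearMap.comp_assoc, hPP])
    simpa using this
  rw [h1, ← ContinuousLinearMap.adjoint_inner_left, hPsa.adjoint_eq]
  exact inner_tubeTransferOperator_self_nonneg ρ hρ hρu hJ (P x)

/-- ★ **The sector top is an attained eigenvalue.**  For continuous unitary `ρ`, central involution `z`, `J ≥ 0` and
a flux `e` with `‖T ∘ P_e‖ > 0`: there is a unit vector `φ` IN the sector (`P_e φ = φ`) with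
`T φ = ‖T ∘ P_e‖ · φ`. [cite: ReedSimonI1980, Thm. VI.16] -/
theorem exists_eigenvector_tubeSectorNorm (hρ : Continuous ρ) (hρu : ∀ g, ρ g ∈ Matrix.unitaryGroup (Fin n) ℂ)
    {z : G} (hz : z ∈ Subgroup.center G) (hz2 : z * z = 1) (hJ : 0 ≤ J) {e : Fin k → ZMod 2}
    (hpos : 0 < tubeSectorNorm ρ z J k L e) :
    ∃ φ : Lp ℝ 2 (sliceMeasure G k L), ‖φ‖ = 1 ∧ tubeFluxProjection z k L e φ = φ ∧
      tubeTransferOperator ρ J k L φ = tubeSectorNorm ρ z J k L e • φ := by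
  set T := tubeTransferOperator ρ J k L
  set P := tubeFluxProjection z k L e
  have hS : tubeSectorNorm ρ z J k L e = ‖T.comp P‖ := rfl
  -- the space is nontrivial (`T ∘ P ≠ 0`)
  have hne : T.comp P ≠ 0 := by
    intro h; rw [hS, h, norm_zero] at hpos; exact lt_irrefl _ hpos
  obtain ⟨x, hx⟩ := DFunLike.ne_iff.1 hne
  haveI : Nontrivial (Lp ℝ 2 (sliceMeasure G k L)) := nontrivial_of_ne _ _ hx
  obtain ⟨φ, hφ1, hφ⟩ := exists_eigenvector_norm_of_re_inner_nonneg (𝕜 := ℝ)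
    (isSelfAdjoint_comp_tubeFluxProjection ρ J hρ hρu hz hz2 e)
    (isCompactOperator_comp_tubeFluxProjection ρ J hρ z e)
    (fun (x : Lp ℝ 2 (sliceMeasure G k L)) => by
      simpa using inner_comp_tubeFluxProjection_self_nonneg ρ J hρ hρu hz hz2 hJ e x)
  have hφ' : T (P φ) = ‖T.comp P‖ • φ := by simpa using hφ
  have hPP : P.comp P = P := tubeFluxProjection_comp_self z hz2 e
  have hPT : P.comp T = T.comp P := tubeFluxProjection_comp_tubeTransferOperator ρ J hρ hz e
  have hnorm : ‖T.comp P‖ ≠ 0 := by rw [← hS]; exact hpos.ne'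
  -- `P φ = φ`: `φ = ‖TP‖⁻¹ • T P φ` and `P T P = T P P = T P`
  have hPφ : P φ = φ := by
    have h1 : P (T (P φ)) = T (P φ) := by
      have := congrArg (fun S : Lp ℝ 2 (sliceMeasure G k L) →L[ℝ] Lp ℝ 2 (sliceMeasure G k L) => S φ)
        (show (P.comp T).comp P = T.comp P by rw [hPT, ContinuousLinearMap.comp_assoc, hPP])
      simpa using this
    rw [hφ', map_smul] at h1
    have h2 := congrArg (fun v => ‖T.comp P‖⁻¹ • v) h1
    simp only [smul_smul, inv_mul_cancel₀ hnorm, one_smul] at h2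
    exact h2
  refine ⟨φ, hφ1, hPφ, ?_⟩
  rw [hS, ← hφ', hPφ]

/-- **Maximality**: every eigenvalue of `T` carried by a vector of the sector `e` lies in `[0, ‖T ∘ P_e‖]`
(`J ≥ 0`). [cite: ReedSimonIV1978, Thm XIII.44] -/
theorem eigenvalue_mem_Icc_of_mem_sector (hρ : Continuous ρ) (hρu : ∀ g, ρ g ∈ Matrix.unitaryGroup (Fin n) ℂ)
    (hJ : 0 ≤ J) (z : G) {e : Fin k → ZMod 2} {ψ : Lp ℝ 2 (sliceMeasure G k L)} {μ : ℝ}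
    (hψP : tubeFluxProjection z k L e ψ = ψ) (hψ : ψ ≠ 0) (heig : tubeTransferOperator ρ J k L ψ = μ • ψ) :
    μ ∈ Set.Icc 0 (tubeSectorNorm ρ z J k L e) := by
  set T := tubeTransferOperator ρ J k L
  set P := tubeFluxProjection z k L e
  have hψn : 0 < ‖ψ‖ := norm_pos_iff.2 hψ
  constructor
  · -- `0 ≤ ⟪ψ, Tψ⟫ = μ ‖ψ‖²`
    have h := inner_tubeTransferOperator_self_nonneg ρ hρ hρu hJ ψ
    rw [heig, inner_smul_right, real_inner_self_eq_norm_sq] at h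
    exact nonneg_of_mul_nonneg_left (by linarith [h]) (pow_pos hψn 2) |> fun h' => by nlinarith [h, pow_pos hψn 2]
  · -- `|μ| ‖ψ‖ = ‖T P ψ‖ ≤ ‖T P‖ ‖ψ‖`
    have h1 : (T.comp P) ψ = μ • ψ := by simp [P, hψP, heig, T]
    have h2 : ‖(T.comp P) ψ‖ ≤ ‖T.comp P‖ * ‖ψ‖ := (T.comp P).le_opNorm ψ
    rw [h1, norm_smul, Real.norm_eq_abs] at h2
    have h3 : |μ| ≤ ‖T.comp P‖ := le_of_mul_le_mul_right h2 hψn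
    exact (le_abs_self μ).trans h3

end General

/-! ### The cell's case: `SU(2)`, fundamental representation, `z = −1`, `J = β/2` -/

section SU2

variable {k L : ℕ} [NeZero L]

/-- ★ **Every sector top of the SU(2) tube is an attained eigenvalue**: for every `β > 0`, slice dimension `k`,
side `L` and flux `e ∈ ℤ₂^k` there is a unit `φ` in the sector `e` with `T̂ φ = λ̂₀^{(e)} φ`,
`λ̂₀^{(e)} = tubeSectorNorm (fundamentalRep (Fin 2)) su2MinusOne (β/2) k L e > 0`. [cite: ReedSimonI1980, Thm. VI.16] -/
theorem su2_exists_eigenvector_tubeSectorNorm {β : ℝ} (hβ : 0 < β) (e : Fin k → ZMod 2) :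
    ∃ φ : Lp ℝ 2 (sliceMeasure (Matrix.specialUnitaryGroup (Fin 2) ℂ) k L), ‖φ‖ = 1 ∧
      tubeFluxProjection su2MinusOne k L e φ = φ ∧
      su2TubeTransferOperator β k L φ = tubeSectorNorm (fundamentalRep (Fin 2)) su2MinusOne (β / 2) k L e • φ := by
  haveI : SecondCountableTopology (Matrix.specialUnitaryGroup (Fin 2) ℂ) :=
    Literature.MathematicalPhysics.QuantumLattice.secondCountableTopology_su2
  have hpos : 0 < tubeSectorNorm (fundamentalRep (Fin 2)) su2MinusOne (β / 2) k L e := by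
    by_cases he : e = 0
    · subst he
      rw [tubeSectorNorm_zero (fundamentalRep (Fin 2)) (β / 2) (continuous_fundamentalRep (Fin 2))
        fundamentalRep_mem_unitaryGroup su2MinusOne_mem_center]
      exact norm_tubeTransferOperator_pos (β / 2) k L (continuous_fundamentalRep (Fin 2))
    · exact su2_tubeSectorNorm_pos hβ.ne' k L he
  exact exists_eigenvector_tubeSectorNorm (fundamentalRep (Fin 2)) (β / 2) (continuous_fundamentalRep (Fin 2))
    fundamentalRep_mem_unitaryGroup su2MinusOne_mem_center su2MinusOne_mul_self (by linarith) hpos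

/-- **The two `λ̂`'s of `E_e` are genuine eigenvalues**: for `β > 0` there are unit vectors `φ₀` (the vacuum) and `φ_e`
(in the sector `e`) with `T̂ φ₀ = λ̂₀ φ₀`, `T̂ φ_e = λ̂₀^{(e)} φ_e`, and
`su2FluxEnergy β k L e = log λ̂₀ − log λ̂₀^{(e)}` — FLOW-PLAN O1's «max spec» reading of the tree's norm-based
definition. [cite: tHooft1979Flux] -/
theorem su2FluxEnergy_eq_log_div {β : ℝ} (hβ : 0 < β) (e : Fin k → ZMod 2) :
    ∃ (lam0 lamE : ℝ) (φ₀ φE : Lp ℝ 2 (sliceMeasure (Matrix.specialUnitaryGroup (Fin 2) ℂ) k L)),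
      0 < lamE ∧ lamE ≤ lam0 ∧ ‖φ₀‖ = 1 ∧ ‖φE‖ = 1 ∧
      su2TubeTransferOperator β k L φ₀ = lam0 • φ₀ ∧
      tubeFluxProjection su2MinusOne k L e φE = φE ∧ su2TubeTransferOperator β k L φE = lamE • φE ∧
      su2FluxEnergy β k L e = Real.log lam0 - Real.log lamE := by
  haveI : SecondCountableTopology (Matrix.specialUnitaryGroup (Fin 2) ℂ) :=
    Literature.MathematicalPhysics.QuantumLattice.secondCountableTopology_su2
  obtain ⟨φE, hE1, hEP, hEeig⟩ := su2_exists_eigenvector_tubeSectorNorm (k := k) (L := L) hβ e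
  obtain ⟨φ₀, h01, -, h0eig, -, -⟩ := exists_vacuum (fundamentalRep (Fin 2)) (β / 2)
    (continuous_fundamentalRep (Fin 2)) fundamentalRep_mem_unitaryGroup su2MinusOne_mem_center (k := k) (L := L)
  have hpos : 0 < tubeSectorNorm (fundamentalRep (Fin 2)) su2MinusOne (β / 2) k L e := by
    by_cases he : e = 0
    · subst he
      rw [tubeSectorNorm_zero (fundamentalRep (Fin 2)) (β / 2) (continuous_fundamentalRep (Fin 2))
        fundamentalRep_mem_unitaryGroup su2MinusOne_mem_center]
      exact norm_tubeTransferOperator_pos (β / 2) k L (continuous_fundamentalRep (Fin 2))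
    · exact su2_tubeSectorNorm_pos hβ.ne' k L he
  refine ⟨‖su2TubeTransferOperator β k L‖, tubeSectorNorm (fundamentalRep (Fin 2)) su2MinusOne (β / 2) k L e,
    φ₀, φE, hpos, tubeSectorNorm_le_norm _ _ _ _ _ _, h01, hE1, h0eig, hEP, hEeig, rfl⟩

end SU2

end Summit.Ventures.YMGap.FlowData
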